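import Literature.Analysis.FluidPDE.NSLerayStrongLocalExistence
import Literature.Analysis.FluidPDE.KatoLerayHopf
import Literature.Analysis.FluidPDE.CheskidovShvydkoyRegularProofs
import Literature.Analysis.FluidPDE.LerayLocalRegularH1Proofs
import Literature.Analysis.FluidPDE.TaoClassGlobal
import HarnessLib

/-!
# Discharge of `leray_strong_local_existence`: Leray's local existence theorem for bounded
# finite-energy data with the lifespan `τ = A ν V⁻²(0)` (Leray 1934, §19; Ożański–Pooley Thm. 6.22)

`Literature.Analysis.FluidPDE.leray_strong_local_existence` (`NSLerayBlowupRate.lean`) is the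
named fact: there is a universal `C > 0` such that for every viscosity `ν > 0` and every weakly
divergence-free datum `u₀ ∈ L²(ℝ³)` with `‖u₀‖_{L^∞} ≤ M`, `0 < M`, there is a pair `(v, q)`
which is a classical solution of the unforced Navier–Stokes system on the open time interval
`(0, C ν / M²)` and a Leray–Hopf weak solution from `u₀` on `[0, T']` for every
`T' ∈ (0, C ν / M²)` (Leray 1934, Acta Math. 63, §19, existence theorem p. 222 with (3.8)
`τ = A ν V⁻²(0)`; Ożański–Pooley 2018, **Thm. 6.22** "If `u₀ ∈ H ∩ L^∞` … there exists a unique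
strong solution `u` … on `[0, T)` with `u(0) = u₀`, where `T > C/‖u₀‖²_∞`", with Cor. 6.16
(strong solutions are classical on `ℝ³ × (0, T)`) and Lemma 6.21 (energy equality from `0`)).
This file proves it: `leray_strong_local_existence_holds`.

## The proof

Leray's construction (§19; Ożański–Pooley, proof of Thm. 6.22, (6.58)–(6.64)) runs Oseen's
successive approximations in `L^∞` with the `L²` norm carried along; the regularity of the
limit is then read off the integral representation (Leray §§15–18; Ożański–Pooley Thm. 6.15,
Cor. 6.16). The tree holds the first half as the proved
`exists_kato_solution_of_memLp_two_of_bound` (`NSLerayStrongLocalExistence.lean`): an absolute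
`c₀ > 0` and, on `[0, T₀)`, `T₀ = c₀ ν / M²`, a Kato solution `w` from `u₀` (duality-form mild
solution in `C([0,T₀); L³)`, `w 0 = u₀`, measurable on the slab) with `‖w(t)‖_{L^∞} ≤ 2M` on
`[0, T₀)`. For the second half this file does **not** bootstrap the mild formulation (the
route of `leray_strong_local_existence_of_classical_of_bounded_mild_L3`, whose leaf
`classical_of_bounded_mild_L3` is not discharged) but goes through the weak formulation, along
two proved tree theorems:

1. **Kato solutions with square-integrable datum are Leray–Hopf weak solutions**
   (`IsKatoSolutionOn.isLerayHopfOn_of_memLp_two`, `KatoLerayHopf.lean`; Escauriaza–Seregin–Šverák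
   2003, Thm. 7.4 with Remark 7.5; Kato 1984, Thm. 4; the energy equality is Galdi's theorem
   `galdi_energy_equality_holds`). Its smoothing hypothesis `‖w(t)‖_∞ ≤ C/√t` on `(0, T₀)` holds
   with `C = 2M √T₀`. Hence `w` is Leray–Hopf from `u₀` on `[0, T]`, `T = T₀ / 2`.
2. **Serrin's regularity criterion** in the class `L^∞(0, T; L^∞)` (`2/∞ + 3/∞ = 0 ≤ 1`)
   (`ladyzhenskaya_prodi_serrin_holds`, `CheskidovShvydkoyRegularProofs.lean`; Serrin 1962;
   Prodi 1959; Robinson–Rodrigo–Sadowski 2016, Thm. 8.17): there is a classical solution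
   `(v, p)` on the time set `(0, T]` with `w(t) = v(t)` a.e. for every `t ∈ (0, T]`.

The velocity `V(t) = v(t)` for `t > 0`, `V(t) = w(t)` for `t ≤ 0` (so `V 0 = u₀`) is then
classical on `(0, T)` with the pressure `p` (`IsClassicalNSSolutionOn.congr_slices`, `.mono`),
jointly continuous hence measurable on `(0, T') × ℝ³`, and a.e. equal slice-wise to `w` on
`[0, T']`, so it is Leray–Hopf from `u₀` on every `[0, T']`, `T' < T`
(`IsLerayHopfOn.congr_ae_slices`, `LerayLocalRegularH1Proofs.lean`). The constant is
`C = c₀ / 2`.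

No statement is changed and no named fact is introduced.

## Mathlib / tree search

Tree (`lean search 'ladyzhenskaya_prodi_serrin_holds|isLerayHopfOn_of_memLp_two|congr_ae_slices|
exists_kato_solution_of_memLp_two_of_bound|memLqLp_of_ae_eLpNorm_le|congr_slices'`): all inputs
above, proved; no `leray_strong_local_existence_holds` existed. Mathlib: `uniqueDiffOn_Ioo`,
`Real.sqrt_le_sqrt`, `ENNReal.div_top`, `ContinuousOn.aestronglyMeasurable`.

## References

* J. Leray, *Sur le mouvement d'un liquide visqueux emplissant l'espace*, Acta Math. 63 (1934),
  193–248: §19, existence theorem (p. 222) and (3.8) (p. 223); §15, §17 (3.4), §32.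
  [Leray1934]
* W. S. Ożański, B. C. Pooley, *Leray's fundamental work on the Navier–Stokes equations: a modern
  review of "Sur le mouvement d'un liquide visqueux emplissant l'espace"*, in: Partial
  Differential Equations in Fluid Mechanics, LMS Lecture Note Ser. 452, CUP 2018, pp. 113–203:
  Thm. 6.22, Cor. 6.16, Thm. 6.15, Lemma 6.21. [OzanskiPooley2018]
* J. Serrin, *On the interior regularity of weak solutions of the Navier–Stokes equations*,
  Arch. Rational Mech. Anal. 9 (1962), 187–195. [Serrin1962]
* L. Escauriaza, G. Seregin, V. Šverák, Russ. Math. Surveys 58:2 (2003), Thm. 7.4, Remark 7.5.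
  [EscauriazaSereginSverak2003]
* T. Kato, *Strong `Lᵖ`-solutions of the Navier–Stokes equation in `ℝᵐ`, with applications to
  weak solutions*, Math. Z. 187 (1984), 471–480, Thm. 4. [Kato1984]
-/

noncomputable section

open MeasureTheory TopologicalSpace Set Function Filter Topology
open scoped ENNReal NNReal

namespace Literature.Analysis.FluidPDE

/-- **Leray's local existence theorem for bounded finite-energy data, with the lifespan
`τ = A ν V⁻²(0)`** (discharge of the named fact `leray_strong_local_existence`; Leray 1934, §19,
existence theorem p. 222 with (3.8); Ożański–Pooley 2018, Thm. 6.22 with Cor. 6.16 and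
Lemma 6.21). Proof (module docstring): the bounded mild solution of Oseen's scheme from `u₀`
on `[0, c₀ν/M²)` (`exists_kato_solution_of_memLp_two_of_bound`) is a Leray–Hopf weak solution
(`IsKatoSolutionOn.isLerayHopfOn_of_memLp_two`; Escauriaza–Seregin–Šverák 2003, Remark 7.5) in
Serrin's class `L^∞ L^∞`, hence has a classical representative on `(0, T]`, `T = c₀ν/(2M²)`
(`ladyzhenskaya_prodi_serrin_holds`; Serrin 1962), which is again Leray–Hopf from `u₀`
(`IsLerayHopfOn.congr_ae_slices`). The constant is `C = c₀ / 2`. [cite: Leray1934, §19 (3.8) pp. 222–223] [cite: OzanskiPooley2018, Thm. 6.22 with Cor. 6.16, Lemma 6.21] [cite: Serrin1962] [cite: EscauriazaSereginSverak2003, Thm. 7.4 with Remark 7.5] -/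
theorem leray_strong_local_existence_holds : leray_strong_local_existence := by
  obtain ⟨c₀, hc₀, hkato⟩ := exists_kato_solution_of_memLp_two_of_bound
  refine ⟨c₀ / 2, half_pos hc₀, ?_⟩
  intro ν hν u₀ M hM hu₀ hdiv hbd
  obtain ⟨w, hK, -, -, htop, -⟩ := hkato hν hM hu₀ hdiv hbd
  have hTeq : c₀ / 2 * ν / M ^ 2 = c₀ * ν / M ^ 2 / 2 := by ring
  set T₀ : ℝ := c₀ * ν / M ^ 2 with hT₀
  have hT₀pos : 0 < T₀ := by positivity
  set T : ℝ := T₀ / 2 with hTdef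
  have hT : 0 < T := half_pos hT₀pos
  have hTT₀ : T < T₀ := half_lt_self hT₀pos
  rw [hTeq]
  -- ### Kato's smoothing bound in the form `‖w t‖_∞ ≤ (2M√T₀)/√t` on `(0, T₀)`
  have hinf : ∀ t ∈ Ioo 0 T₀,
      eLpNorm (w t) ∞ volume ≤ ENNReal.ofReal (2 * M * Real.sqrt T₀ / Real.sqrt t) := by
    intro t ht
    refine (htop t ⟨ht.1.le, ht.2⟩).trans (ENNReal.ofReal_le_ofReal ?_)
    rw [le_div_iff₀ (Real.sqrt_pos.2 ht.1)]
    exact mul_le_mul_of_nonneg_left (Real.sqrt_le_sqrt ht.2.le) (by positivity)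
  -- ### `w` is a Leray–Hopf weak solution from `u₀` on `[0, T]` (ESS 2003, Remark 7.5)
  have hLH : IsLerayHopfOn T ν 0 u₀ w := (hK.isLerayHopfOn_of_memLp_two hν hu₀ hinf hTT₀ hT).1
  -- ### `w` lies in Serrin's class `L^∞(0, T; L^∞)`
  have hS : MemLqLp ∞ ∞ w (Ioo 0 T) := by
    refine memLqLp_of_ae_eLpNorm_le (C := ENNReal.ofReal (2 * M)) ENNReal.ofReal_ne_top ?_ ?_ ?_
    · rw [Real.volume_Ioo]; exact ENNReal.ofReal_ne_top
    · exact (ae_restrict_iff' measurableSet_Ioo).2 (Eventually.of_forall fun t ht =>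
        ⟨(hK.memLp ⟨ht.1.le, ht.2.trans hTT₀⟩).1,
          (htop t ⟨ht.1.le, ht.2.trans hTT₀⟩).trans_lt ENNReal.ofReal_lt_top⟩)
    · exact (ae_restrict_iff' measurableSet_Ioo).2 (Eventually.of_forall fun t ht =>
        htop t ⟨ht.1.le, ht.2.trans hTT₀⟩)
  -- ### Serrin's regularity criterion: a classical representative on `(0, T]`
  have hr : (3 : ℝ≥0∞) < ∞ := ENNReal.ofNat_lt_top
  have hqr : 2 / (∞ : ℝ≥0∞) + 3 / (∞ : ℝ≥0∞) ≤ 1 := by simp [ENNReal.div_top]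
  obtain ⟨v, p, hcl, hae⟩ := ladyzhenskaya_prodi_serrin_holds hν hT hLH hr hqr hS
  -- ### the velocity `V`: `v` at positive times, `w` (hence `u₀`) at `t ≤ 0`
  set V : ℝ → EuclideanSpace ℝ (Fin 3) → EuclideanSpace ℝ (Fin 3) := fun t => if 0 < t then v t else w t with hV
  have hVpos : ∀ t : ℝ, 0 < t → V t = v t := fun t ht => by simp only [hV, if_pos ht]
  have hV0 : V 0 = u₀ := by simp only [hV, lt_irrefl, if_false, hK.initial]
  have hclV : IsClassicalNSSolutionOn (Ioc 0 T) ν 0 V p :=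
    hcl.congr_slices (fun t ht => hVpos t ht.1) fun _ _ => rfl
  refine ⟨V, p, hclV.mono Ioo_subset_Ioc_self (uniqueDiffOn_Ioo 0 T), fun T' hT' => ?_⟩
  -- ### Leray–Hopf from `u₀` on `[0, T']`, `T' < T`, by slice-wise a.e. modification
  have hVm : AEStronglyMeasurable (uncurry V) (volume.restrict (Ioo 0 T' ×ˢ univ)) := by
    have hc : ContinuousOn (uncurry V) (Ioo 0 T' ×ˢ univ) :=
      hclV.smooth_velocity.continuousOn.mono
        (prod_mono (fun t ht => ⟨ht.1, ht.2.le.trans hT'.2.le⟩) Subset.rfl)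
    exact hc.aestronglyMeasurable (measurableSet_Ioo.prod MeasurableSet.univ)
  refine (hLH.of_le hT'.2.le).congr_ae_slices hT'.1 hVm fun t ht => ?_
  rcases ht.1.eq_or_lt with h | h
  · rw [← h, hV0, hK.initial]
  · rw [hVpos t h]
    exact (hae t ⟨h, ht.2.trans hT'.2.le⟩).symm

end Literature.Analysis.FluidPDE

end
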